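import Mathlib
import Literature.Computability.AlgebraicComplexity.MS21AffineOrbitInterpolatingSets
import HarnessLib

/-!
# Medini–Shpilka 2021, Cor 36 (existence and size, as typed): interpolating sets for the affine
# orbit of the canonical read-once ANF polynomial — discharge of `MS2021_cor_36`

The named fact `MS2021_cor_36` of `MS21DenseOrbitsHittingSets.lean` types MS Cor 36 (CCC 2021 LIPIcs
200:19, p.19:13 = arXiv Cor 1.22) as EXISTENCE AND SIZE ONLY: one constant `c` such that for
`4^Δ ≤ n` and `|F| ≥ n²` (or `F` infinite) some set of `≤ n^{c(Δ+1)} + c` points is an interpolating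
set for `ANF_Δ^{GLaff_n(F)}`.

As typed this follows from the difference-class coefficient cover of
`MS21AffineOrbitInterpolatingSets.lean` (`MS2021.AffineOrbitCoeff.exists_hittingSet_affOrbit_sub`,
parameters `(A, b, A', b')`, engine `CoeffCover.exists_hittingSet`): `deg ANF_Δ ≤ 2^Δ ≤ 4^Δ ≤ n`
(`totalDegree_anf_le`), so on a `2n`-grid there is an interpolating set with
`≤ (2(n²+n))(log₂((2n)ⁿ n + 1) + 1) + 1 ≤ 17·n⁴ ≤ n^{17(Δ+1)} + 17` points (`MS2021_cor_36_holds`,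
`c = 17`; the bound does not even grow with `Δ`). Disclosed deviation: existence by parametrisation +
coefficient cover, not the explicit generator of the printed proof (Thm 35 + [23]).

Theorem-only file; no definitions, no new named facts. `VP ≠ VNP` is NOT proved and nothing here bears
on it.

## References
* [MediniShpilka2021] D. Medini, A. Shpilka, CCC 2021, LIPIcs 200:19, Def 8 and Cor 36 (p.19:7,
  19:13; = arXiv Cor 1.22).
* J. Heintz, C.-P. Schnorr, STOC 1980, Thm 4.4 (coefficient-cover engine).
-/

noncomputable section

open MvPolynomial

namespace Literature.Computability.AlgebraicComplexity

open HittingSets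

namespace MS2021

namespace Cor36

variable {K : Type*} [Field K]

/-- `deg ANF_Δ ≤ 2^Δ` (Def 8: `ANF_0 = x_1`, `ANF_{Δ+1} = ANF_Δ·ANF_Δ + ANF_Δ·ANF_Δ` on disjoint blocks).
[cite: MediniShpilka2021, Def 8 (CCC p.19:7)] -/
theorem totalDegree_anf_le : ∀ Δ : ℕ, (anf K Δ).totalDegree ≤ 2 ^ Δ
  | 0 => by
    simp only [anf, pow_zero]
    exact (totalDegree_X _).le
  | Δ + 1 => by
    have ih := totalDegree_anf_le Δ
    have hr : ∀ i : Fin 4, (rename (anfBlock Δ i) (anf K Δ)).totalDegree ≤ 2 ^ Δ :=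
      fun i => (totalDegree_rename_le _ _).trans ih
    simp only [anf]
    have h2 : 2 ^ Δ + 2 ^ Δ = 2 ^ (Δ + 1) := by ring
    refine (totalDegree_add _ _).trans (max_le ?_ ?_)
    · exact (totalDegree_mul _ _).trans (h2 ▸ add_le_add (hr 0) (hr 1))
    · exact (totalDegree_mul _ _).trans (h2 ▸ add_le_add (hr 2) (hr 3))

/-- `2^Δ ≤ 4^Δ`. [folklore] -/
private theorem two_pow_le_four_pow (Δ : ℕ) : 2 ^ Δ ≤ 4 ^ Δ :=
  Nat.pow_le_pow_left (by norm_num) Δ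

/-- The size arithmetic, inner part: `(2(n² + n))(log₂((2n)ⁿ n + 1) + 1) + 1 ≤ 17 n⁴` (`n ≥ 1`).
[folklore] -/
private theorem inner_bound (n : ℕ) (hn : 1 ≤ n) :
    (n * n + n + (n * n + n)) * (Nat.log 2 ((2 * n) ^ n * n + 1) + 1) + 1 ≤ 17 * n ^ 4 := by
  have h2n : 2 * n ≤ 2 ^ (n + 1) := by
    have := (Nat.lt_two_pow_self (n := n)).le
    rw [pow_succ]; omega
  have hpow : (2 * n) ^ n * n + 1 < 2 ^ (n * n + 2 * n + 1) := by
    have h1 : (2 * n) ^ n ≤ 2 ^ ((n + 1) * n) := by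
      rw [pow_mul]; exact Nat.pow_le_pow_left h2n n
    have h2 : n ≤ 2 ^ n := (Nat.lt_two_pow_self (n := n)).le
    have h3 : (2 * n) ^ n * n ≤ 2 ^ (n * n + 2 * n) := by
      calc (2 * n) ^ n * n ≤ 2 ^ ((n + 1) * n) * 2 ^ n := Nat.mul_le_mul h1 h2
        _ = 2 ^ (n * n + 2 * n) := by rw [← pow_add]; ring_nf
    have h4 : 1 < 2 ^ (n * n + 2 * n) := Nat.one_lt_two_pow (by nlinarith)
    rw [pow_succ]; omega
  have hlog : Nat.log 2 ((2 * n) ^ n * n + 1) + 1 ≤ n * n + 2 * n + 1 := by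
    have := Nat.log_lt_of_lt_pow (by positivity) hpow
    omega
  have hn1 : n ≤ n ^ 4 := by
    calc n = n ^ 1 := (pow_one n).symm
      _ ≤ n ^ 4 := Nat.pow_le_pow_right hn (by norm_num)
  have hn2 : n ^ 2 ≤ n ^ 4 := Nat.pow_le_pow_right hn (by norm_num)
  have hn3 : n ^ 3 ≤ n ^ 4 := Nat.pow_le_pow_right hn (by norm_num)
  have hn4 : 1 ≤ n ^ 4 := Nat.one_le_pow _ _ hn
  calc (n * n + n + (n * n + n)) * (Nat.log 2 ((2 * n) ^ n * n + 1) + 1) + 1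
      ≤ (n * n + n + (n * n + n)) * (n * n + 2 * n + 1) + 1 :=
        Nat.add_le_add_right (Nat.mul_le_mul_left _ hlog) 1
    _ = 2 * n ^ 4 + 6 * n ^ 3 + 6 * n ^ 2 + 2 * n + 1 := by ring
    _ ≤ 17 * n ^ 4 := by linarith

/-- The size arithmetic, outer part: `17 n⁴ ≤ n^{17(Δ+1)} + 17` (`n ≥ 1`). [folklore] -/
private theorem outer_bound (n Δ : ℕ) (hn : 1 ≤ n) : 17 * n ^ 4 ≤ n ^ (17 * (Δ + 1)) + 17 := by
  rcases Nat.lt_or_ge n 2 with hlt | hge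
  · obtain rfl : n = 1 := by omega
    simp
  · have h17 : n ^ 17 ≤ n ^ (17 * (Δ + 1)) := Nat.pow_le_pow_right hn (by omega)
    have h13 : 2 ^ 13 ≤ n ^ 13 := Nat.pow_le_pow_left hge 13
    have hsplit : n ^ 17 = n ^ 4 * n ^ 13 := by rw [← pow_add]
    have : 17 * n ^ 4 ≤ n ^ 4 * n ^ 13 := by
      rw [mul_comm]
      exact Nat.mul_le_mul_left _ (le_trans (by norm_num) h13)
    omega

end Cor36

end MS2021

/-- **MS Cor 36 (`MS2021_cor_36`, existence and size as typed), DISCHARGED** with `c = 17`: for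
`4^Δ ≤ n` and `|F| ≥ n²` (or `F` infinite) some set of at most `n^{17(Δ+1)} + 17` (indeed `17·n⁴`)
points is an interpolating set for `ANF_Δ^{GLaff_n(F)}`. Route (disclosed): parametrisation of the
differences + coefficient cover (`MS2021.AffineOrbitCoeff.exists_hittingSet_affOrbit_sub`).
[cite: MediniShpilka2021, Cor 36 (CCC 2021 LIPIcs 200:19, p.19:13; = arXiv:2102.05632 Cor 1.22)] -/
theorem MS2021_cor_36_holds : MS2021_cor_36 := by
  classical
  refine ⟨17, fun K _ n Δ hΔn hK => ?_⟩
  have hn : 1 ≤ n := le_trans (Nat.one_le_pow _ _ (by norm_num)) hΔn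
  -- a grid of exactly `2n` field elements
  have hS : ∃ S : Finset K, S.card = 2 * n := by
    by_cases hinf : Infinite K
    · exact Infinite.exists_subset_card_eq K (2 * n)
    · haveI : Fintype K := fintypeOfNotInfinite hinf
      have hcard : n ^ 2 ≤ Nat.card K := hK.resolve_left hinf
      have h2 : 2 * n ≤ (Finset.univ : Finset K).card := by
        rw [Finset.card_univ]
        rcases Nat.lt_or_ge n 2 with hlt | hge
        · have : 1 < Fintype.card K := Fintype.one_lt_card
          omega
        · have : n ^ 2 ≤ Fintype.card K := by rwa [Nat.card_eq_fintype_card] at hcard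
          nlinarith
      obtain ⟨S, -, hS⟩ := Finset.exists_subset_card_eq h2
      exact ⟨S, hS⟩
  obtain ⟨S, hScard⟩ := hS
  have hS1 : S.Nonempty := Finset.card_pos.mp (by omega)
  have hdeg : (MS2021.anf K Δ).totalDegree ≤ n :=
    ((MS2021.Cor36.totalDegree_anf_le Δ).trans (MS2021.Cor36.two_pow_le_four_pow Δ)).trans hΔn
  obtain ⟨H, -, hHcard, hhit⟩ :=
    MS2021.AffineOrbitCoeff.exists_hittingSet_affOrbit_sub (K := K) (n := n) (d := n) hΔn hΔn
      (MS2021.anf K Δ) (MS2021.anf K Δ) hdeg hdeg S hS1 (by omega)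
  refine ⟨H, hHcard.trans ?_,
    MS2021.AffineOrbitCoeff.isInterpolatingSetFor_of_hits_sub _ _ hhit⟩
  rw [hScard]
  exact (MS2021.Cor36.inner_bound n hn).trans (MS2021.Cor36.outer_bound n Δ hn)

end Literature.Computability.AlgebraicComplexity

end
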